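import Literature.Probability.LatticeModels.RegularScalesAbundance
import HarnessLib

/-!
# Separated regular scales (Aizenman–Duminil-Copin 2021, §6.2: the set `𝒦`)

Topic `Literature/Probability/LatticeModels`. Theorems only; **no named fact is introduced** (D-0026).

M. Aizenman, H. Duminil-Copin, Ann. of Math. **194** (2021) = arXiv:1912.07973, §6.2, p. 23: "From now on, fix a
set `𝒦` of regular scales `k` with `m ≤ 2^k ≤ M/2` satisfying that distinct `k, k' ∈ 𝒦` are differing by a
multiplicative factor at least `C` (where the constant `C` is given by Theorem 5.12). We further assume that
`|𝒦| ≥ c₁ log(N/n)`, where `c₁` is sufficiently small. The existence of `𝒦` is guaranteed by the definition of `m`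
and `M` and the abundance of regular scales given by Theorem 5.12."

* `exists_separated_subset` — a finite set of naturals has a subset of size `≥ 1/L₀` of it whose elements are
  `L₀`-separated (a residue class modulo `L₀`);
* `exists_regular_separated_scales` — **the set `𝒦`**: constants `c₀, C₀, L₀, c_K, C_K` such that for
  `0 < β ≤ β_c` and dyadic bounds `2^a ≤ 2^b` in the window with `5a ≤ 2b`, there is a set `𝒦` of
  `(c₀,C₀)`-regular scales in `[a,b]`, pairwise separated (`(C₀+2)2^k < 2^{k'}` for `k < k'`), of size
  `≥ c_K(b-a) - C_K` (`RegularScalesAbundance.abundance_of_regularScales`, Theorem 5.12).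

## References

* M. Aizenman, H. Duminil-Copin, Ann. of Math. 194 (2021), arXiv:1912.07973, §6.2, the set 𝒦 (p. 23); Thm 5.12
  (p. 20) [AizenmanDuminilCopinAnnals2021].
-/

noncomputable section

open Finset

namespace Literature.Probability.LatticeModels

/-- **A separated large subset**: for `L₀ ≥ 1`, every finite set `s ⊆ ℕ` contains a subset `t` with
`#s ≤ L₀ · #t` whose elements are pairwise at distance `≥ L₀` (a largest residue class modulo `L₀`). [folklore] -/
theorem exists_separated_subset (s : Finset ℕ) {L₀ : ℕ} (hL : 0 < L₀) :
    ∃ t ⊆ s, (∀ a ∈ t, ∀ b ∈ t, a < b → a + L₀ ≤ b) ∧ #s ≤ L₀ * #t := by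
  classical
  set f : ℕ → Finset ℕ := fun i => s.filter fun k => k % L₀ = i with hf
  obtain ⟨i₀, hi₀, hmax⟩ := Finset.exists_max_image (Finset.range L₀) (fun i => #(f i)) ⟨0, by simp [hL]⟩
  refine ⟨f i₀, Finset.filter_subset _ _, fun a ha b hb hab => ?_, ?_⟩
  · rw [hf, mem_filter] at ha hb
    have hdvd : L₀ ∣ b - a := by
      have : (b - a) % L₀ = 0 := Nat.sub_mod_eq_zero_of_mod_eq (by rw [hb.2, ha.2])
      exact Nat.dvd_of_mod_eq_zero this
    have := Nat.le_of_dvd (by omega) hdvd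
    omega
  · have hcover : s ⊆ (Finset.range L₀).biUnion f := by
      intro k hk
      rw [mem_biUnion]
      exact ⟨k % L₀, mem_range.2 (Nat.mod_lt k hL), by rw [hf, mem_filter]; exact ⟨hk, rfl⟩⟩
    calc #s ≤ #((Finset.range L₀).biUnion f) := card_le_card hcover
      _ ≤ ∑ i ∈ Finset.range L₀, #(f i) := card_biUnion_le
      _ ≤ ∑ i ∈ Finset.range L₀, #(f i₀) := Finset.sum_le_sum fun i hi => hmax i hi
      _ = L₀ * #(f i₀) := by rw [Finset.sum_const, card_range, smul_eq_mul]

open scoped Classical in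
/-- **The set `𝒦` of separated regular scales.** There are constants `c₀, C₀ > 0`, `L₀ ≥ 1` with
`C₀ + 2 < 2^{L₀}`, `c_K > 0` and `C_K` such that: for `0 < β ≤ β_c` and `1 ≤ a ≤ b` with `5a ≤ 2b` and `2^b` in the
window, some set `𝒦 ⊆ [a,b]` of `(c₀,C₀)`-regular scales of `S_β`, pairwise separated (`(C₀+2)2^k < 2^{k'}` for
`k < k'` in `𝒦`), has `#𝒦 ≥ c_K(b-a) - C_K`. [cite: AizenmanDuminilCopinAnnals2021, arXiv:1912.07973 §6.2, the set 𝒦 (p. 23), from Thm 5.12 (p. 20)] -/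
theorem exists_regular_separated_scales :
    ∃ c₀ C₀ : ℝ, ∃ L₀ : ℕ, ∃ cK CK : ℝ, 0 < c₀ ∧ 0 < C₀ ∧ 0 < L₀ ∧ (C₀ + 2 < (2 : ℝ) ^ L₀) ∧ 0 < cK ∧
      ∀ β : ℝ, 0 < β → β ≤ criticalBeta 4 → ∀ a b : ℕ, 1 ≤ a → 5 * a ≤ 2 * b →
        (β = criticalBeta 4 ∨ (0 < β ∧ ((2 ^ b : ℕ) : ℝ) * invCorrLength (twoPointPlus 4 β) ≤ 1)) →
        ∃ 𝒦 : Finset ℕ, (∀ k ∈ 𝒦, a ≤ k ∧ k ≤ b) ∧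
          (∀ k ∈ 𝒦, IsRegularScale (twoPointFree 4 β) c₀ C₀ (2 ^ k)) ∧
          (∀ k ∈ 𝒦, ∀ k' ∈ 𝒦, k < k' → (C₀ + 2) * 2 ^ k < (2 ^ k' : ℝ)) ∧
          cK * ((b : ℝ) - a) - CK ≤ #𝒦 := by
  obtain ⟨c₀, C₀, c₁, C₁, hc₀, hC₀, hc₁, H⟩ := abundance_of_regularScales (α := 5 / 2) (by norm_num)
  set L₀ : ℕ := ⌈C₀⌉₊ + 2 with hL₀
  have hL₀pos : 0 < L₀ := by omega
  have hsep : C₀ + 2 < (2 : ℝ) ^ L₀ := by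
    rw [hL₀, pow_add]
    have h1 : C₀ ≤ ⌈C₀⌉₊ := Nat.le_ceil C₀
    have h2 : ((⌈C₀⌉₊ : ℕ) : ℝ) < (2 : ℝ) ^ ⌈C₀⌉₊ := by
      have := Nat.lt_two_pow_self (n := ⌈C₀⌉₊)
      exact_mod_cast this
    have h3 : (1 : ℝ) ≤ (2 : ℝ) ^ ⌈C₀⌉₊ := one_le_pow₀ (by norm_num)
    nlinarith
  refine ⟨c₀, C₀, L₀, c₁ * Real.log 2 / L₀, (C₁ + L₀) / L₀, hc₀, hC₀, hL₀pos, hsep, by positivity, ?_⟩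
  intro β hβ hβc a b ha hab hwin
  have hL₀r : (0 : ℝ) < L₀ := by exact_mod_cast hL₀pos
  -- the abundance count between `2^a` and `2^b`
  have hab' : a ≤ b := by omega
  have hpow : (((2 ^ a : ℕ) : ℝ)) ^ (5 / 2 : ℝ) ≤ ((2 ^ b : ℕ) : ℝ) := by
    push_cast
    rw [← Real.rpow_natCast 2 a, ← Real.rpow_mul (by norm_num), ← Real.rpow_natCast 2 b]
    exact Real.rpow_le_rpow_of_exponent_le (by norm_num) (by
      have : (5 * a : ℝ) ≤ 2 * b := by exact_mod_cast hab
      linarith)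
  have hcount := H β hβ hβc (2 ^ a) (2 ^ b) (Nat.one_le_two_pow) hpow hwin
  -- work with the counted set abstractly (its decidability instance is irrelevant)
  suffices key : ∀ s : Finset ℕ, (∀ k ∈ s, 2 ^ a ≤ 2 ^ k ∧ 2 ^ k ≤ 2 ^ b ∧ IsRegularScale (twoPointFree 4 β) c₀ C₀ (2 ^ k)) →
      c₁ * Real.log (((2 ^ b : ℕ) : ℝ) / (2 ^ a : ℕ)) - C₁ ≤ #s →
      ∃ 𝒦 : Finset ℕ, (∀ k ∈ 𝒦, a ≤ k ∧ k ≤ b) ∧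
          (∀ k ∈ 𝒦, IsRegularScale (twoPointFree 4 β) c₀ C₀ (2 ^ k)) ∧
          (∀ k ∈ 𝒦, ∀ k' ∈ 𝒦, k < k' → (C₀ + 2) * 2 ^ k < (2 ^ k' : ℝ)) ∧
          c₁ * Real.log 2 / L₀ * ((b : ℝ) - a) - (C₁ + L₀) / L₀ ≤ #𝒦 by
    refine key _ (fun k hk => ?_) hcount
    rw [Finset.mem_filter] at hk
    exact hk.2
  intro s hsP hcount
  obtain ⟨t, hts, htsep, hcard⟩ := exists_separated_subset s hL₀pos
  refine ⟨t, fun k hk => ?_, fun k hk => ?_, fun k hk k' hk' hkk' => ?_, ?_⟩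
  · have h := hsP k (hts hk)
    exact ⟨(Nat.pow_le_pow_iff_right (by norm_num)).1 h.1, (Nat.pow_le_pow_iff_right (by norm_num)).1 h.2.1⟩
  · exact (hsP k (hts hk)).2.2
  · have hgap := htsep k hk k' hk' hkk'
    calc (C₀ + 2) * 2 ^ k < (2 : ℝ) ^ L₀ * 2 ^ k := mul_lt_mul_of_pos_right hsep (by positivity)
      _ = 2 ^ (k + L₀) := by rw [pow_add]; ring
      _ ≤ 2 ^ k' := pow_le_pow_right₀ (by norm_num) hgap
  · -- `#t ≥ #s/L₀ ≥ (c₁ (b-a) log 2 - C₁)/L₀`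
    have hlog : Real.log (((2 ^ b : ℕ) : ℝ) / (2 ^ a : ℕ)) = ((b : ℝ) - a) * Real.log 2 := by
      push_cast
      rw [← zpow_natCast, ← zpow_natCast, ← zpow_sub₀ (by norm_num), Real.log_zpow]
      push_cast [Nat.cast_sub hab']
      ring
    rw [hlog] at hcount
    have hst : (#s : ℝ) ≤ L₀ * #t := by exact_mod_cast hcard
    rw [div_mul_eq_mul_div, sub_le_iff_le_add, div_le_iff₀ hL₀r]
    have : (C₁ + ↑L₀) / ↑L₀ * ↑L₀ = C₁ + L₀ := by field_simp
    nlinarith [hcount, hst, this, hL₀r]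

end Literature.Probability.LatticeModels
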